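import Literature.NumberTheory.PAdicHodge.AinfRamifiedFormalGroupPoints
import Literature.NumberTheory.PAdicHodge.AinfRamifiedTorsionLift
import Literature.NumberTheory.GaloisRepresentations.LubinTate
import HarnessLib

/-!
# The Eisenstein coefficient ring `𝒪_D = ℤ_p[X]/(f)` satisfies the hypotheses of Lubin–Tate's lemma

Topic `Literature/NumberTheory/PAdicHodge`; THEOREMS ONLY; sequel of `EisensteinRootDatum` (`D.Coeff = AdjoinRoot D.poly` for a
monic Eisenstein `f = D.poly ∈ ℤ_p[X]` of degree `e ≥ 1`) and `AinfRamifiedFormalGroupPoints` §6 (its discrete copy `CoeffDisc D`),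
feeding the tree's abstract Lubin–Tate lemma `GaloisRepresentations.LubinTate` (`IsLTRing π q A`: `π` regular, `1 − π^m` units,
`q = p^r` with `p ∈ πA`, `a^q ≡ a (mod π)`).

For `A = 𝒪_D` and `ϖ = X mod f`:
* §1 `root_pow_e_mem_span_natCast` (`ϖ^e ∈ pA`), `natCast_mem_span_root` (`p ∈ ϖA`: the constant coefficient of `f` is `p·unit`),
  `exists_nat_sub_mem_span_root` (`A = ℤ + ϖA`, i.e. `A/ϖ = 𝔽_p`), `root_dvd_pow_sub` (`ϖ ∣ a^{p^r} − a`);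
* §2 `isUnit_one_sub_natCast_mul` — **`1 − p y ∈ A^×`** for every `y` (the norm `N_{A/ℤ_p}(1 − py) ≡ 1 (mod p)` is a unit of `ℤ_p`,
  so multiplication by `1 − py` is bijective on the free `ℤ_p`-module `A`), whence `isUnit_one_sub_root_pow` (`1 − ϖ^m ∈ A^×`,
  `m ≥ 1`, as `ϖ^{me} ∈ pA`) and `eq_zero_of_root_mul_eq_zero` (`ϖ` is regular: `p ∈ ϖA` and `A` is `p`-torsion-free,
  tree `Coeff.eq_zero_of_natCast_mul_eq_zero`);
* §3 **`isLTRing_coeff : IsLTRing ϖ (p^r) 𝒪_D`** and, transported along `CoeffDisc.of`, **`isLTRing_coeffDisc`** — so the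
  Lubin–Tate series `[a]_f`, `F_f` of `f = ϖX + X^{p^r}` exist OVER `𝒪_D` (tree `LubinTate.hom`, `LubinTate.formalGroup`) and can be
  evaluated on `A_inf(𝒪_D)` and on `𝔪_{ℂ_F}` with the discrete coefficient ring `CoeffDisc D`; `IsLTRing.of_ringEquiv` is the
  transport lemma.

No definitions, no named facts, no `sorry`. Nothing about Galois representations is proved here.

## References
* J. Lubin, J. Tate, *Formal complex multiplication in local fields*, Ann. of Math. 81 (1965), §1. [LubinTate1965]
* J.-P. Serre, *Local class field theory* (Cassels–Fröhlich Ch. VI), §3.5 Prop. 5 and Remark 2. [CasselsFrohlichANT1967]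
* J.-P. Serre, *Local Fields* (1979), Ch. I §6 Prop. 17–18. [SerreLocalFields1979]
-/

noncomputable section

open Ideal Polynomial

namespace Literature.NumberTheory.GaloisRepresentations.LubinTate.IsLTRing

/-- **Transport of the Lubin–Tate hypotheses along a ring isomorphism.** [cite: CasselsFrohlichANT1967, Ch. VI §3.5 Remark 2] -/
theorem of_ringEquiv {A B : Type*} [CommRing A] [CommRing B] (e : A ≃+* B) {π : A} {q : ℕ} (h : IsLTRing π q) :
    IsLTRing (e π) q := by
  refine ⟨fun x hx => ?_, fun m hm => ?_, ?_, fun b => ?_⟩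
  · have h1 : π * e.symm x = 0 := by
      apply e.injective
      rw [map_mul, e.apply_symm_apply, map_zero, hx]
    have h2 := h.eq_zero_of_mul_eq_zero _ h1
    simpa using congrArg e h2
  · have h1 := (h.isUnit_one_sub_pow m hm).map e
    rwa [map_sub, map_one, map_pow] at h1
  · obtain ⟨p, r, hp, hq, hmem⟩ := h.exists_prime
    refine ⟨p, r, hp, hq, ?_⟩
    rw [Ideal.mem_span_singleton] at hmem ⊢
    have h1 := map_dvd e hmem
    rwa [map_natCast] at h1
  · have h1 := map_dvd e (h.dvd_pow_sub (e.symm b))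
    rwa [map_sub, map_pow, e.apply_symm_apply] at h1

end Literature.NumberTheory.GaloisRepresentations.LubinTate.IsLTRing

namespace Literature.NumberTheory.PAdicHodge.EisensteinRoot

open Literature.NumberTheory.GaloisRepresentations
open Literature.NumberTheory.GaloisRepresentations.IsNonarchimedeanLocalField
open Literature.NumberTheory.GaloisRepresentations.LubinTate
open Field ValuativeRel

variable {F : Type} [Field F] [ValuativeRel F] [TopologicalSpace F] [IsNonarchimedeanLocalField F] [CharZero F]
  {p : ℕ} [Fact p.Prime] {hp : valuation F p < 1} (D : EisensteinRoot F p hp)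

/-! ## §1 `ϖ^e ∈ pA`, `p ∈ ϖA`, `A/ϖ = 𝔽_p` -/

/-- **`ϖ^e ∈ p𝒪_D`** (`f(ϖ) = 0` and the non-leading coefficients of `f` are divisible by `p`).
[cite: SerreLocalFields1979, Ch. I §6 Prop. 17] -/
theorem root_pow_e_mem_span_natCast : AdjoinRoot.root D.poly ^ D.e ∈ Ideal.span {(p : D.Coeff)} := by
  have has : D.poly = X ^ D.e + ∑ i ∈ Finset.range D.e, C (D.poly.coeff i) * X ^ i := by
    rw [e_def]; exact D.monic.as_sum
  have h0 : (X ^ D.e + ∑ i ∈ Finset.range D.e, C (D.poly.coeff i) * X ^ i).eval₂ (AdjoinRoot.of D.poly)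
      (AdjoinRoot.root D.poly) = 0 := by
    rw [← has]; exact AdjoinRoot.eval₂_root D.poly
  rw [eval₂_add, eval₂_pow, eval₂_X, eval₂_finsetSum] at h0
  have h2 : ∑ i ∈ Finset.range D.e, (C (D.poly.coeff i) * X ^ i).eval₂ (AdjoinRoot.of D.poly) (AdjoinRoot.root D.poly) =
      ∑ i ∈ Finset.range D.e, AdjoinRoot.of D.poly (D.poly.coeff i) * AdjoinRoot.root D.poly ^ i :=
    Finset.sum_congr rfl fun i _ => by rw [eval₂_mul, eval₂_C, eval₂_X_pow]
  have h1 : AdjoinRoot.root D.poly ^ D.e =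
      -∑ i ∈ Finset.range D.e, AdjoinRoot.of D.poly (D.poly.coeff i) * AdjoinRoot.root D.poly ^ i := by
    rw [← h2]
    exact eq_neg_of_add_eq_zero_left h0
  rw [h1]
  refine (Ideal.neg_mem_iff _).2 (Ideal.sum_mem _ fun i hi => Ideal.mul_mem_right _ _ ?_)
  obtain ⟨c, hc⟩ := D.dvd_coeff (Finset.mem_range.1 hi)
  rw [hc, map_mul, map_natCast]
  exact Ideal.mul_mem_right _ _ (Ideal.mem_span_singleton_self _)

/-- **`p ∈ ϖ𝒪_D`**: the constant coefficient `c₀ = p·u` of `f` equals `−ϖ·(f − c₀)/X (ϖ)`.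
[cite: SerreLocalFields1979, Ch. I §6 Prop. 17] -/
theorem natCast_mem_span_root : (p : D.Coeff) ∈ Ideal.span {AdjoinRoot.root D.poly} := by
  obtain ⟨g, hg⟩ := Polynomial.X_dvd_iff.2 (show (D.poly - C (D.poly.coeff 0)).coeff 0 = 0 by simp)
  have h1 : AdjoinRoot.of D.poly (D.poly.coeff 0) = -(AdjoinRoot.root D.poly * AdjoinRoot.mk D.poly g) := by
    have h3 : D.poly = C (D.poly.coeff 0) + X * g := by rw [← hg]; ring
    have h2 : AdjoinRoot.mk D.poly (C (D.poly.coeff 0) + X * g) = 0 := by rw [← h3]; exact AdjoinRoot.mk_self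
    rw [map_add, map_mul, AdjoinRoot.mk_C, AdjoinRoot.mk_X] at h2
    exact eq_neg_of_add_eq_zero_left h2
  obtain ⟨u, hu⟩ := D.exists_coeff_zero_eq_mul_unit
  have h4 : (p : D.Coeff) = AdjoinRoot.of D.poly (D.poly.coeff 0) * AdjoinRoot.of D.poly ((u⁻¹ : ℤ_[p]ˣ) : ℤ_[p]) := by
    rw [hu, map_mul, map_natCast, mul_assoc, ← map_mul, Units.mul_inv, map_one, mul_one]
  rw [h4, h1, neg_mul, mul_assoc]
  exact (Ideal.neg_mem_iff _).2 (Ideal.mul_mem_right _ _ (Ideal.mem_span_singleton_self _))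

/-- **`𝒪_D = ℤ + ϖ𝒪_D`**: every element is congruent to a natural number modulo `ϖ` (`A = ℤ_p + ϖA`, `ℤ_p = ℤ + pℤ_p`,
`p ∈ ϖA`); i.e. `𝒪_D/ϖ = 𝔽_p`. [cite: SerreLocalFields1979, Ch. I §6 Prop. 18] -/
theorem exists_nat_sub_mem_span_root (a : D.Coeff) : ∃ n : ℕ, a - n ∈ Ideal.span {AdjoinRoot.root D.poly} := by
  obtain ⟨h, rfl⟩ := AdjoinRoot.mk_surjective a
  obtain ⟨h', hh'⟩ := Polynomial.X_dvd_iff.2 (show (h - C (h.coeff 0)).coeff 0 = 0 by simp)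
  have h1 : AdjoinRoot.mk D.poly h = AdjoinRoot.of D.poly (h.coeff 0) + AdjoinRoot.root D.poly * AdjoinRoot.mk D.poly h' := by
    have h3 : h = C (h.coeff 0) + X * h' := by rw [← hh']; ring
    conv_lhs => rw [h3]
    rw [map_add, map_mul, AdjoinRoot.mk_C, AdjoinRoot.mk_X]
  obtain ⟨n, -, hn⟩ := PadicInt.exists_mem_range (h.coeff 0)
  rw [PadicInt.maximalIdeal_eq_span_p, Ideal.mem_span_singleton'] at hn
  obtain ⟨c, hc⟩ := hn
  refine ⟨n, ?_⟩
  have h2 : AdjoinRoot.mk D.poly h - n =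
      AdjoinRoot.of D.poly c * (p : D.Coeff) + AdjoinRoot.root D.poly * AdjoinRoot.mk D.poly h' := by
    rw [h1, ← map_natCast (AdjoinRoot.of D.poly) p, ← map_mul, hc, map_sub, map_natCast]
    ring
  rw [h2]
  exact Ideal.add_mem _ (Ideal.mul_mem_left _ _ D.natCast_mem_span_root)
    (Ideal.mul_mem_right _ _ (Ideal.mem_span_singleton_self _))

/-- **`ϖ ∣ a^{p^r} − a`** for all `a ∈ 𝒪_D` (`a ≡ n ∈ ℕ (mod ϖ)` and `p ∣ n^{p^r} − n`, Fermat).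
[cite: CasselsFrohlichANT1967, Ch. VI §3.5 Remark 2] -/
theorem root_dvd_pow_sub (r : ℕ) (a : D.Coeff) : AdjoinRoot.root D.poly ∣ a ^ p ^ r - a := by
  have hp : p.Prime := Fact.out
  obtain ⟨n, hn⟩ := D.exists_nat_sub_mem_span_root a
  rw [← Ideal.mem_span_singleton, ← Ideal.Quotient.eq_zero_iff_mem, map_sub, map_pow]
  set Q := D.Coeff ⧸ Ideal.span {AdjoinRoot.root D.poly}
  have ha : Ideal.Quotient.mk (Ideal.span {AdjoinRoot.root D.poly}) a = (n : Q) := by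
    rw [← sub_eq_zero, ← map_natCast (Ideal.Quotient.mk (Ideal.span {AdjoinRoot.root D.poly})) n, ← map_sub,
      Ideal.Quotient.eq_zero_iff_mem]
    exact hn
  have hp0 : (p : Q) = 0 := by
    rw [← map_natCast (Ideal.Quotient.mk (Ideal.span {AdjoinRoot.root D.poly})) p, Ideal.Quotient.eq_zero_iff_mem]
    exact D.natCast_mem_span_root
  have hdvd : (p : ℤ) ∣ (n : ℤ) ^ p ^ r - n := by
    rw [← ZMod.intCast_zmod_eq_zero_iff_dvd]
    push_cast
    rw [ZMod.pow_card_pow, sub_self]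
  obtain ⟨m, hm⟩ := hdvd
  rw [ha]
  calc (n : Q) ^ p ^ r - n = (((n : ℤ) ^ p ^ r - n : ℤ) : Q) := by push_cast; ring
    _ = ((p * m : ℤ) : Q) := by rw [hm]
    _ = 0 := by rw [Int.cast_mul, Int.cast_natCast, hp0, zero_mul]

/-! ## §2 Units `1 − py`, `1 − ϖ^m`; `ϖ` is regular -/

/-- **`1 − p y` is a unit of `𝒪_D`** for every `y`: its norm to `ℤ_p` is `≡ 1 (mod p)`, hence a unit, so multiplication by
`1 − py` is a bijection of the free `ℤ_p`-module `𝒪_D`. [cite: SerreLocalFields1979, Ch. I §6 Prop. 18] -/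
theorem isUnit_one_sub_natCast_mul (y : D.Coeff) : IsUnit (1 - (p : D.Coeff) * y) := by
  classical
  set B := AdjoinRoot.powerBasis' (R := ℤ_[p]) D.monic with hB
  haveI : Module.Finite ℤ_[p] D.Coeff := B.finite
  haveI : Module.Free ℤ_[p] D.Coeff := Module.Free.of_basis B.basis
  have hx : (1 : D.Coeff) - (p : D.Coeff) * y = 1 - (p : ℤ_[p]) • y := by
    rw [Algebra.smul_def, map_natCast]
  have hN : IsUnit (Algebra.norm ℤ_[p] ((1 : D.Coeff) - (p : ℤ_[p]) • y)) := by
    rw [Algebra.norm_eq_matrix_det B.basis, map_sub, map_one, map_smul]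
    have h1 : PadicInt.toZMod ((1 - (p : ℤ_[p]) • Algebra.leftMulMatrix B.basis y).det) = 1 := by
      rw [RingHom.map_det, RingHom.mapMatrix_apply, Matrix.map_sub _ (map_sub _), Matrix.map_one _ (map_zero _) (map_one _),
        Matrix.map_smul' _ _ _ (map_mul _), map_natCast, ZMod.natCast_self, zero_smul, sub_zero, Matrix.det_one]
    by_contra hnu
    have hmem : (1 - (p : ℤ_[p]) • Algebra.leftMulMatrix B.basis y).det ∈ IsLocalRing.maximalIdeal ℤ_[p] :=
      (IsLocalRing.mem_maximalIdeal _).2 hnu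
    rw [← PadicInt.ker_toZMod, RingHom.mem_ker, h1] at hmem
    exact one_ne_zero hmem
  have hL : IsUnit (Algebra.lmul ℤ_[p] D.Coeff ((1 : D.Coeff) - (p : ℤ_[p]) • y)) :=
    (LinearMap.isUnit_iff_isUnit_det _).2 (by rw [← Algebra.norm_apply]; exact hN)
  obtain ⟨z, hz⟩ := ((Module.End.isUnit_iff _).1 hL).2 1
  rw [hx]
  exact IsUnit.of_mul_eq_one z hz

/-- **`1 − ϖ^m ∈ 𝒪_D^×` for `m ≥ 1`** (`(1 − ϖ^m)·Σ_{i<e} ϖ^{mi} = 1 − ϖ^{me}` and `ϖ^{me} ∈ p𝒪_D`).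
[cite: CasselsFrohlichANT1967, Ch. VI §3.5 Remark 2] -/
theorem isUnit_one_sub_root_pow {m : ℕ} (hm : 0 < m) : IsUnit (1 - AdjoinRoot.root D.poly ^ m) := by
  have h1 : (1 - AdjoinRoot.root D.poly ^ m) * ∑ i ∈ Finset.range D.e, (AdjoinRoot.root D.poly ^ m) ^ i =
      1 - AdjoinRoot.root D.poly ^ (D.e * m) := by
    rw [mul_neg_geom_sum, ← pow_mul, mul_comm]
  have h2 : AdjoinRoot.root D.poly ^ (D.e * m) ∈ Ideal.span {(p : D.Coeff)} := by
    rw [pow_mul]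
    exact Ideal.pow_mem_of_mem _ D.root_pow_e_mem_span_natCast m hm
  obtain ⟨c, hc⟩ := Ideal.mem_span_singleton'.1 h2
  obtain ⟨u, hu⟩ := D.isUnit_one_sub_natCast_mul c
  rw [← hc, mul_comm c, ← hu] at h1
  exact IsUnit.of_mul_eq_one ((∑ i ∈ Finset.range D.e, (AdjoinRoot.root D.poly ^ m) ^ i) * ↑u⁻¹)
    (by rw [← mul_assoc, h1, Units.mul_inv])

/-- **`ϖ` is a non-zero-divisor of `𝒪_D`** (`p ∈ ϖ𝒪_D` and `𝒪_D` is `p`-torsion-free).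
[cite: CasselsFrohlichANT1967, Ch. VI §3.5 Remark 2] -/
theorem eq_zero_of_root_mul_eq_zero {x : D.Coeff} (h : AdjoinRoot.root D.poly * x = 0) : x = 0 := by
  obtain ⟨c, hc⟩ := Ideal.mem_span_singleton'.1 D.natCast_mem_span_root
  exact Coeff.eq_zero_of_natCast_mul_eq_zero (D := D) (by rw [← hc, mul_assoc, h, mul_zero])

/-! ## §3 `IsLTRing ϖ (p^r) 𝒪_D` -/

/-- **`(𝒪_D, ϖ, p^r)` satisfies the hypotheses of Lubin–Tate's lemma** (Cassels–Fröhlich VI §3.5 Prop. 5, Remark 2): `ϖ` is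
regular, `1 − ϖ^m` are units, `p ∈ ϖ𝒪_D`, and `a^{p^r} ≡ a (mod ϖ)` (`𝒪_D/ϖ = 𝔽_p`). Hence the Lubin–Tate series of
`f = ϖX + X^{p^r}` — the formal group `F_f` and its endomorphisms `[a]_f`, `a ∈ 𝒪_D` — exist with coefficients in `𝒪_D`.
[cite: CasselsFrohlichANT1967, Ch. VI §3.5 Prop. 5, Remark 2] [cite: LubinTate1965, §1 Lemma 1] -/
theorem isLTRing_coeff (r : ℕ) : IsLTRing (AdjoinRoot.root D.poly) (p ^ r) :=
  ⟨fun _ hx => D.eq_zero_of_root_mul_eq_zero hx, fun _ hm => D.isUnit_one_sub_root_pow hm,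
    ⟨p, r, Fact.out, rfl, D.natCast_mem_span_root⟩, D.root_dvd_pow_sub r⟩

/-- **The same for the discrete copy `CoeffDisc D`** of `𝒪_D` (transport along `CoeffDisc.of`), the coefficient ring over which
formal series are evaluated in `A_inf(𝒪_D)` and in `𝔪_{ℂ_F}`. [cite: CasselsFrohlichANT1967, Ch. VI §3.5 Prop. 5, Remark 2] -/
theorem isLTRing_coeffDisc (r : ℕ) : IsLTRing (CoeffDisc.of D (AdjoinRoot.root D.poly)) (p ^ r) :=
  IsLTRing.of_ringEquiv (CoeffDisc.of D) (D.isLTRing_coeff r)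

end Literature.NumberTheory.PAdicHodge.EisensteinRoot

end
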